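import Summits.Ventures.PackingBounds.Configurations.CL18Vectors
import Summits.Ventures.PackingBounds.Configurations.CL18Codes
import Summits.Ventures.PackingBounds.Configurations.CL17

/-!
# Cohn–Li in dimension `18`, III: the eight vector families, `7654` vectors

Framing: lottery ticket; floor = certified bounds/negative ranges. Venture `PackingBounds` (cell
`pub-packcert`, seat `pub-packcert-energy`).

The integer model (scale `6`; `√2`-axis doubled, `√6`-axis as `(2s, s, s)`, see `CL18Vectors.lean`) of the Cohn–Li
`18`-dimensional kissing configuration [Cohn–Li 2024, §4]:
* `setA18`: `(±12) e_k + (±12) e_l` (`480`);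
* `setB18`: `±6` odd patterns on the pairs and squares (`3840`);
* `setX18`: `±6` odd patterns on the crosses, `±6` on the `√2`-axis (`1024`);
* `setY`: `±6` odd patterns on the `32` extra words, `(e, g) = ±(3, 3)` (class `A`) or `±(3, −3)` (class `B`) (`2048`);
* `setT18`: `±12` on the `√2`-axis (`2`); `setU`: `(±6, ±6)` on the two axes (`4`);
* `setD18`: `±4` on all cells with the signs of `c ∈ C₈`, `√2`-axis `4 · (−1)^{χ(c)}` (`256`).
Grouped as `setA18`, `setO = B ∪ X ∪ Y` (odd patterns), `setW = T ∪ U` (axis vectors), `setD18`. This file proves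
the parametrisations injective, the parts disjoint, and **`|cl18Int| = 7654`**, and presents every odd-pattern
vector uniformly through the combined table `wd`, `eT`, `gT` of `CL18Codes.lean`.

## References
* H. Cohn, A. Li, *Improved kissing numbers in seventeen through twenty-one dimensions*, arXiv:2411.04916 (2024), §4. [`CohnLi2024`]
-/

namespace Summit.Ventures.PackingBounds.Config.CL17

open Finset Leech Golay

/-! ### The eight parts -/

/-- Shape `A` (scale `6`): `(±12) e_k + (±12) e_l`. [cite: CohnLi2024, §4] -/
def aV18 (k l : Fin 24) (a b : Bool) : Fin 24 → ℤ := pvec {k, l} (fun j => if j = k then a else b) 12 0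

/-- Shape `A`: `480` vectors. -/
def setA18 : Finset (Fin 24 → ℤ) :=
  (idxA ×ˢ (univ : Finset (Bool × Bool))).image fun q => aV18 q.1.1 q.1.2 q.2.1 q.2.2

/-- Shape `B`: odd `±6` patterns on the pairs and squares, `3840` vectors. [cite: CohnLi2024, §4] -/
def setB18 : Finset (Fin 24 → ℤ) :=
  ((univ : Finset (Fin 30)) ×ˢ range 128).image fun q => qvec (supp (w8 q.1)) (pat8 q.1 q.2) 6 0 0

/-- Shape `X`: odd `±6` patterns on the crosses, `±6` on the `√2`-axis, `1024` vectors. [cite: CohnLi2024, §4] -/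
def setX18 : Finset (Fin 24 → ℤ) :=
  (((univ : Finset (Fin 16)) ×ˢ range 32) ×ˢ (univ : Finset Bool)).image
    fun q => qvec (supp (x6 q.1.1)) (pat6 q.1.1 q.1.2) 6 (6 * sgn q.2) 0

/-- `√6`-axis sign of the extra word `i`: `+3` for class `A` (`i < 16`), `−3` for class `B`. -/
def gY (i : Fin 32) : ℤ := if i.val < 16 then 3 else -3

/-- Shape `Y`: odd `±6` patterns on the extra words with axes `±(3, ±3)`, `2048` vectors. [cite: CohnLi2024, §4] -/
def setY : Finset (Fin 24 → ℤ) :=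
  (((univ : Finset (Fin 32)) ×ˢ range 32) ×ˢ (univ : Finset Bool)).image
    fun q => qvec (supp (y6 q.1.1)) (paty q.1.1 q.1.2) 6 (3 * sgn q.2) (gY q.1.1 * sgn q.2)

/-- Shape `T`: `±12` on the `√2`-axis, `2` vectors. [cite: CohnLi2024, §4] -/
def setT18 : Finset (Fin 24 → ℤ) := (univ : Finset Bool).image fun c => qvec ∅ (fun _ => false) 0 (12 * sgn c) 0

/-- Shape `U`: `(±6, ±6)` on the two axes, `4` vectors. [cite: CohnLi2024, §4] -/
def setU : Finset (Fin 24 → ℤ) :=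
  (univ : Finset (Bool × Bool)).image fun q => qvec ∅ (fun _ => false) 0 (6 * sgn q.1) (6 * sgn q.2)

/-- Shape `D` (deep holes of the odd `17`-dimensional configuration indexed by `C₈`, twisted by `χ`), `256` vectors.
[cite: CohnLi2024, §4] -/
def setD18 : Finset (Fin 24 → ℤ) :=
  (range 256).image fun m => qvec cells (fun j => (c8 m).testBit j.val) 4 (4 * sgn (chi (c8 m))) 0

/-- The odd-pattern part `B ∪ X ∪ Y`. -/
def setO : Finset (Fin 24 → ℤ) := setB18 ∪ setX18 ∪ setY

/-- The axis part `T ∪ U`. -/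
def setW : Finset (Fin 24 → ℤ) := setT18 ∪ setU

/-- **The Cohn–Li `18`-dimensional configuration, integer model** (`7654` vectors of norm `288` in `ℤ²⁴`).
[cite: CohnLi2024, Thm. 1.1, §4] -/
def cl18Int : Finset (Fin 24 → ℤ) := setA18 ∪ setO ∪ setW ∪ setD18

attribute [irreducible] setA18 setB18 setX18 setY setT18 setU setD18

/-! ### Membership -/

/-- Members of `A`. -/
theorem mem_setA18 {x : Fin 24 → ℤ} :
    x ∈ setA18 ↔ ∃ k l : Fin 24, ∃ a b : Bool, (k < l ∧ l.val < 16) ∧ x = aV18 k l a b := by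
  simp only [setA18, idxA, mem_image, mem_product, mem_filter, mem_univ, true_and, and_true, Prod.exists]
  constructor
  · rintro ⟨k, l, a, b, hkl, rfl⟩; exact ⟨k, l, a, b, hkl, rfl⟩
  · rintro ⟨k, l, a, b, hkl, rfl⟩; exact ⟨k, l, a, b, hkl, rfl⟩

/-- Members of `B`. -/
theorem mem_setB18 {x : Fin 24 → ℤ} :
    x ∈ setB18 ↔ ∃ i : Fin 30, ∃ v < 128, x = qvec (supp (w8 i)) (pat8 i v) 6 0 0 := by
  simp only [setB18, mem_image, mem_product, mem_univ, mem_range, true_and, Prod.exists]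
  constructor
  · rintro ⟨i, v, hv, rfl⟩; exact ⟨i, v, hv, rfl⟩
  · rintro ⟨i, v, hv, rfl⟩; exact ⟨i, v, hv, rfl⟩

/-- Members of `X`. -/
theorem mem_setX18 {x : Fin 24 → ℤ} :
    x ∈ setX18 ↔ ∃ i : Fin 16, ∃ v < 32, ∃ c : Bool, x = qvec (supp (x6 i)) (pat6 i v) 6 (6 * sgn c) 0 := by
  simp only [setX18, mem_image, mem_product, mem_univ, mem_range, true_and, and_true, Prod.exists]
  constructor
  · rintro ⟨i, v, c, hv, rfl⟩; exact ⟨i, v, hv, c, rfl⟩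
  · rintro ⟨i, v, hv, c, rfl⟩; exact ⟨i, v, c, hv, rfl⟩

/-- Members of `Y`. -/
theorem mem_setY {x : Fin 24 → ℤ} : x ∈ setY ↔
    ∃ i : Fin 32, ∃ v < 32, ∃ c : Bool, x = qvec (supp (y6 i)) (paty i v) 6 (3 * sgn c) (gY i * sgn c) := by
  simp only [setY, mem_image, mem_product, mem_univ, mem_range, true_and, and_true, Prod.exists]
  constructor
  · rintro ⟨i, v, c, hv, rfl⟩; exact ⟨i, v, hv, c, rfl⟩
  · rintro ⟨i, v, hv, c, rfl⟩; exact ⟨i, v, c, hv, rfl⟩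

/-- Members of `T`. -/
theorem mem_setT18 {x : Fin 24 → ℤ} : x ∈ setT18 ↔ ∃ c : Bool, x = qvec ∅ (fun _ => false) 0 (12 * sgn c) 0 := by
  simp only [setT18, mem_image, mem_univ, true_and]
  constructor
  · rintro ⟨c, rfl⟩; exact ⟨c, rfl⟩
  · rintro ⟨c, rfl⟩; exact ⟨c, rfl⟩

/-- Members of `U`. -/
theorem mem_setU {x : Fin 24 → ℤ} :
    x ∈ setU ↔ ∃ c c' : Bool, x = qvec ∅ (fun _ => false) 0 (6 * sgn c) (6 * sgn c') := by
  simp only [setU, mem_image, mem_univ, true_and, Prod.exists]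
  constructor
  · rintro ⟨c, c', rfl⟩; exact ⟨c, c', rfl⟩
  · rintro ⟨c, c', rfl⟩; exact ⟨c, c', rfl⟩

/-- Members of `D`. -/
theorem mem_setD18 {x : Fin 24 → ℤ} :
    x ∈ setD18 ↔ ∃ m < 256, x = qvec cells (fun j => (c8 m).testBit j.val) 4 (4 * sgn (chi (c8 m))) 0 := by
  simp only [setD18, mem_image, mem_range]
  constructor
  · rintro ⟨m, hm, rfl⟩; exact ⟨m, hm, rfl⟩
  · rintro ⟨m, hm, rfl⟩; exact ⟨m, hm, rfl⟩

/-- Members of the whole configuration. -/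
theorem mem_cl18Int {x : Fin 24 → ℤ} (hx : x ∈ cl18Int) : x ∈ setA18 ∨ x ∈ setO ∨ x ∈ setW ∨ x ∈ setD18 := by
  rw [cl18Int] at hx
  simp only [mem_union] at hx
  tauto

/-- **Uniform presentation of the odd-pattern part** through the combined table. -/
theorem exists_of_mem_setO {x : Fin 24 → ℤ} (hx : x ∈ setO) : ∃ i < 78, ∃ f : Fin 24 → Bool, ∃ c : Bool,
    Odd ((supp (wd i)).filter fun j => f j = true).card ∧ x = qvec (supp (wd i)) f 6 (eT i * sgn c) (gT i * sgn c) := by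
  rw [setO, mem_union, mem_union] at hx
  rcases hx with (hx | hx) | hx
  · obtain ⟨i, v, _, rfl⟩ := mem_setB18.mp hx
    refine ⟨i.val, by omega, pat8 i v, false, ?_, ?_⟩
    · rw [wd_w8 i.isLt]; exact odd_card_pat8 i v
    · simp [wd_w8 i.isLt, eT, gT, i.isLt, show i.val < 46 by omega]
  · obtain ⟨i, v, _, c, rfl⟩ := mem_setX18.mp hx
    refine ⟨30 + i.val, by omega, pat6 i v, c, ?_, ?_⟩
    · rw [wd_x6 i.isLt]; exact odd_card_pat6 i v
    · simp [wd_x6 i.isLt, eT, gT, show ¬ (30 + i.val < 30) by omega, show 30 + i.val < 46 by omega]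
  · obtain ⟨i, v, _, c, rfl⟩ := mem_setY.mp hx
    refine ⟨46 + i.val, by omega, paty i v, c, ?_, ?_⟩
    · rw [wd_y6 i.isLt]; exact odd_card_paty i v
    · simp only [wd_y6 i.isLt, eT, gT, gY, show ¬ (46 + i.val < 30) by omega, show ¬ (46 + i.val < 46) by omega,
        if_false, show (46 + i.val < 62) = (i.val < 16) by apply propext; omega]

/-! ### Supports are cells -/

/-- The support of an extra word consists of cells. -/
theorem supp_y6_sub (i : Fin 32) : supp (y6 i) ⊆ cells := by
  rw [← wd_y6 i.isLt]; exact supp_wd_sub (by omega)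

/-! ### Cardinalities -/

/-- `|A| = 480`. -/
theorem card_setA18 : setA18.card = 480 := by
  rw [setA18, card_image_of_injOn, card_product, card_idxA]
  · simp
  rintro ⟨⟨k, l⟩, ⟨a, b⟩⟩ hq ⟨⟨k', l'⟩, ⟨a', b'⟩⟩ hq' h
  simp only [coe_product, Set.mem_prod, mem_coe, idxA, mem_filter, mem_product, mem_univ, true_and, and_true]
    at hq hq'
  obtain ⟨hkl, hl⟩ := hq
  obtain ⟨hkl', hl'⟩ := hq'
  have hk : k.val < 16 := lt_trans hkl hl
  have hk' : k'.val < 16 := lt_trans hkl' hl'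
  change aV18 k l a b = aV18 k' l' a' b' at h
  unfold aV18 at h
  have h12 : (12 : ℤ) ≠ 0 := by norm_num
  have hsupp : ({k, l} : Finset (Fin 24)) = {k', l'} := by
    rw [← nz_pvec_eq (pair_sub hk hl) (fun j => if j = k then a else b) h12 0,
      ← nz_pvec_eq (pair_sub hk' hl') (fun j => if j = k' then a' else b') h12 0, h]
  have h1 : k = k' ∨ k = l' := by
    have : k ∈ ({k', l'} : Finset (Fin 24)) := by rw [← hsupp]; simp
    simpa using this
  have h2 : l = k' ∨ l = l' := by
    have : l ∈ ({k', l'} : Finset (Fin 24)) := by rw [← hsupp]; simp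
    simpa using this
  have hkk : k = k' ∧ l = l' := by
    simp only [Fin.ext_iff, Fin.lt_def] at h1 h2 hkl hkl' ⊢
    omega
  obtain ⟨rfl, rfl⟩ := hkk
  have hne : k ≠ l := ne_of_lt hkl
  obtain ⟨hf, -⟩ := pvec_eq_pvec (pair_sub hk hl) h12 h
  have ha := hf k (by simp)
  have hb := hf l (by simp)
  simp only [if_true, if_neg hne.symm] at ha hb
  subst ha hb; rfl

/-- `|B| = 3840`. -/
theorem card_setB18 : setB18.card = 3840 := by
  rw [setB18, card_image_of_injOn]
  · simp
  rintro ⟨i, v⟩ hq ⟨i', v'⟩ hq' h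
  simp only [coe_product, Set.mem_prod, mem_coe, mem_univ, mem_range, true_and] at hq hq'
  change qvec (supp (w8 i)) (pat8 i v) 6 0 0 = qvec (supp (w8 i')) (pat8 i' v') 6 0 0 at h
  have h6 : (6 : ℤ) ≠ 0 := by norm_num
  have hsupp : supp (w8 i) = supp (w8 i') := by
    rw [← nz_qvec_eq (supp_w8_sub i) (pat8 i v) h6 0 0, ← nz_qvec_eq (supp_w8_sub i') (pat8 i' v') h6 0 0, h]
  have hii : i = i' := Fin.ext (w8_inj i.isLt i'.isLt hsupp)
  subst hii
  obtain ⟨hf, -⟩ := qvec_eq_qvec (supp_w8_sub i) h6 h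
  rw [pat8_inj hq hq' hf]

set_option maxRecDepth 100000 in
/-- `|X| = 1024`. -/
theorem card_setX18 : setX18.card = 1024 := by
  rw [setX18, card_image_of_injOn]
  · simp
  rintro ⟨⟨i, v⟩, c⟩ hq ⟨⟨i', v'⟩, c'⟩ hq' h
  simp only [coe_product, Set.mem_prod, mem_coe, mem_univ, mem_range, true_and, and_true] at hq hq'
  change qvec (supp (x6 i)) (pat6 i v) 6 (6 * sgn c) 0 = qvec (supp (x6 i')) (pat6 i' v') 6 (6 * sgn c') 0 at h
  have h6 : (6 : ℤ) ≠ 0 := by norm_num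
  have hsupp : supp (x6 i) = supp (x6 i') := by
    rw [← nz_qvec_eq (supp_x6_sub i) (pat6 i v) h6 (6 * sgn c) 0,
      ← nz_qvec_eq (supp_x6_sub i') (pat6 i' v') h6 (6 * sgn c') 0, h]
  have hii : i = i' := Fin.ext (x6_inj i.isLt i'.isLt hsupp)
  subst hii
  obtain ⟨hf, he, -⟩ := qvec_eq_qvec (supp_x6_sub i) h6 h
  have hc : c = c' := sgn_injective (by omega)
  subst hc
  rw [pat6_inj hq hq' hf]

set_option maxRecDepth 100000 in
/-- `|Y| = 2048`. -/
theorem card_setY : setY.card = 2048 := by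
  rw [setY, card_image_of_injOn]
  · simp
  rintro ⟨⟨i, v⟩, c⟩ hq ⟨⟨i', v'⟩, c'⟩ hq' h
  simp only [coe_product, Set.mem_prod, mem_coe, mem_univ, mem_range, true_and, and_true] at hq hq'
  change qvec (supp (y6 i)) (paty i v) 6 (3 * sgn c) (gY i * sgn c) =
    qvec (supp (y6 i')) (paty i' v') 6 (3 * sgn c') (gY i' * sgn c') at h
  have h6 : (6 : ℤ) ≠ 0 := by norm_num
  have hsupp : supp (y6 i) = supp (y6 i') := by
    rw [← nz_qvec_eq (supp_y6_sub i) (paty i v) h6 (3 * sgn c) (gY i * sgn c),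
      ← nz_qvec_eq (supp_y6_sub i') (paty i' v') h6 (3 * sgn c') (gY i' * sgn c'), h]
  have hii : i = i' := by
    rw [← wd_y6 i.isLt, ← wd_y6 i'.isLt] at hsupp
    exact Fin.ext (by have := wd_inj (by omega) (by omega) hsupp; omega)
  subst hii
  obtain ⟨hf, he, -⟩ := qvec_eq_qvec (supp_y6_sub i) h6 h
  have hc : c = c' := sgn_injective (by omega)
  subst hc
  rw [paty_inj hq hq' hf]

/-- `|T| = 2`. -/
theorem card_setT18 : setT18.card = 2 := by
  rw [setT18, card_image_of_injective]
  · simp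
  intro c c' h
  change qvec ∅ (fun _ => false) 0 (12 * sgn c) 0 = qvec ∅ (fun _ => false) 0 (12 * sgn c') 0 at h
  have hc := congrFun h 16
  rw [(qvec_apply_16_17 (Finset.empty_subset _) _ _ _ _).1,
    (qvec_apply_16_17 (Finset.empty_subset _) _ _ _ _).1] at hc
  exact sgn_injective (by omega)

/-- `|U| = 4`. -/
theorem card_setU : setU.card = 4 := by
  rw [setU, card_image_of_injective]
  · simp
  rintro ⟨c, d⟩ ⟨c', d'⟩ h
  change qvec ∅ (fun _ => false) 0 (6 * sgn c) (6 * sgn d) = qvec ∅ (fun _ => false) 0 (6 * sgn c') (6 * sgn d') at h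
  have hc := congrFun h 16
  have hd := congrFun h 19
  rw [(qvec_apply_16_17 (Finset.empty_subset _) _ _ _ _).1,
    (qvec_apply_16_17 (Finset.empty_subset _) _ _ _ _).1] at hc
  rw [(qvec_apply_18_19_20 (Finset.empty_subset _) _ _ _ _).2.1,
    (qvec_apply_18_19_20 (Finset.empty_subset _) _ _ _ _).2.1] at hd
  have h1 : c = c' := sgn_injective (by omega)
  have h2 : d = d' := sgn_injective (by omega)
  rw [h1, h2]

/-- `|D| = 256`. -/
theorem card_setD18 : setD18.card = 256 := by
  rw [setD18, card_image_of_injOn]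
  · simp
  intro m hm m' hm' h
  simp only [coe_range, Set.mem_Iio] at hm hm'
  change qvec cells (fun j => (c8 m).testBit j.val) 4 (4 * sgn (chi (c8 m))) 0 =
    qvec cells (fun j => (c8 m').testBit j.val) 4 (4 * sgn (chi (c8 m'))) 0 at h
  by_contra hne
  obtain ⟨hf, -, -⟩ := qvec_eq_qvec subset_rfl (by norm_num : (4 : ℤ) ≠ 0) h
  have h0 : wtK 16 (c8 m ^^^ c8 m') = 0 := by
    rw [← card_cells_filter_xor, Finset.inter_self, Finset.card_eq_zero, Finset.filter_eq_empty_iff]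
    intro j hj
    rw [hf j hj]; simp
  rcases wtK_c8_xor hm hm' hne with h6 | ⟨h4, -⟩ <;> omega

/-! ### Invariants separating the parts -/

/-- Nonzero cells: `A` has `2`. -/
theorem nz_setA18 {x : Fin 24 → ℤ} (hx : x ∈ setA18) : (cells.filter fun j => x j ≠ 0).card = 2 := by
  obtain ⟨k, l, a, b, ⟨hkl, hl⟩, rfl⟩ := mem_setA18.mp hx
  rw [aV18, card_nz_pvec (pair_sub (lt_trans hkl hl) hl) _ (by norm_num), Finset.card_pair (ne_of_lt hkl)]

/-- Nonzero cells: `O` has `8` or `6`; and coordinate `19` distinguishes `X` (`0`) from `Y` (`≠ 0`). -/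
theorem nz_setO {x : Fin 24 → ℤ} (hx : x ∈ setO) :
    (cells.filter fun j => x j ≠ 0).card = 8 ∨ (cells.filter fun j => x j ≠ 0).card = 6 := by
  obtain ⟨i, hi, f, c, -, rfl⟩ := exists_of_mem_setO hx
  rw [nz_qvec_eq (supp_wd_sub hi) f (by norm_num) _ _, card_supp_wd hi]
  split_ifs <;> simp

/-- Nonzero cells: `W` has `0`. -/
theorem nz_setW {x : Fin 24 → ℤ} (hx : x ∈ setW) : (cells.filter fun j => x j ≠ 0).card = 0 := by
  rw [Finset.card_eq_zero, Finset.filter_eq_empty_iff]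
  intro j hj
  rw [setW, mem_union] at hx
  rcases hx with hx | hx
  · obtain ⟨c, rfl⟩ := mem_setT18.mp hx
    rw [qvec_apply_of_lt _ _ _ _ _ (mem_cells.mp hj)]; simp
  · obtain ⟨c, c', rfl⟩ := mem_setU.mp hx
    rw [qvec_apply_of_lt _ _ _ _ _ (mem_cells.mp hj)]; simp

/-- Nonzero cells: `D` has `16`. -/
theorem nz_setD18 {x : Fin 24 → ℤ} (hx : x ∈ setD18) : (cells.filter fun j => x j ≠ 0).card = 16 := by
  obtain ⟨m, _, rfl⟩ := mem_setD18.mp hx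
  rw [nz_qvec_eq subset_rfl _ (by norm_num), card_cells]

/-- `|O| = 3840 + 1024 + 2048 = 6912`. -/
theorem card_setO : setO.card = 6912 := by
  have hBX : Disjoint setB18 setX18 := by
    refine disjoint_of_nz (p := 8) (q := 6) (by norm_num) (fun x hx => ?_) (fun x hx => ?_)
    · obtain ⟨i, v, _, rfl⟩ := mem_setB18.mp hx
      rw [nz_qvec_eq (supp_w8_sub i) _ (by norm_num), card_supp_w8]
    · obtain ⟨i, v, _, c, rfl⟩ := mem_setX18.mp hx
      rw [nz_qvec_eq (supp_x6_sub i) _ (by norm_num), card_supp_x6]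
  have hBY : Disjoint setB18 setY := by
    refine disjoint_of_nz (p := 8) (q := 6) (by norm_num) (fun x hx => ?_) (fun x hx => ?_)
    · obtain ⟨i, v, _, rfl⟩ := mem_setB18.mp hx
      rw [nz_qvec_eq (supp_w8_sub i) _ (by norm_num), card_supp_w8]
    · obtain ⟨i, v, _, c, rfl⟩ := mem_setY.mp hx
      rw [nz_qvec_eq (supp_y6_sub i) _ (by norm_num), card_supp_y6]
  have hXY : Disjoint setX18 setY := by
    rw [Finset.disjoint_left]
    intro x hX hY
    obtain ⟨i, v, _, c, rfl⟩ := mem_setX18.mp hX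
    obtain ⟨i', v', _, c', h⟩ := mem_setY.mp hY
    have e := congrFun h 19
    rw [(qvec_apply_18_19_20 (supp_x6_sub i) _ _ _ _).2.1, (qvec_apply_18_19_20 (supp_y6_sub i') _ _ _ _).2.1] at e
    unfold gY at e
    rcases sgn_cases c' with h1 | h1 <;> rw [h1] at e <;> split_ifs at e <;> omega
  rw [setO, card_union_of_disjoint (disjoint_union_left.mpr ⟨hBY, hXY⟩), card_union_of_disjoint hBX,
    card_setB18, card_setX18, card_setY]

/-- `|W| = 2 + 4 = 6`. -/
theorem card_setW : setW.card = 6 := by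
  have hTU : Disjoint setT18 setU := by
    rw [Finset.disjoint_left]
    intro x hT hU
    obtain ⟨c, rfl⟩ := mem_setT18.mp hT
    obtain ⟨c', d', h⟩ := mem_setU.mp hU
    have e := congrFun h 19
    rw [(qvec_apply_18_19_20 (Finset.empty_subset _) _ _ _ _).2.1,
      (qvec_apply_18_19_20 (Finset.empty_subset _) _ _ _ _).2.1] at e
    rcases sgn_cases d' with h1 | h1 <;> rw [h1] at e <;> omega
  rw [setW, card_union_of_disjoint hTU, card_setT18, card_setU]

/-- **`|cl18Int| = 480 + 6912 + 6 + 256 = 7654`.** -/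
theorem card_cl18Int : cl18Int.card = 7654 := by
  have hO : ∀ x ∈ setO, (cells.filter fun j => x j ≠ 0).card ≠ 2 ∧ (cells.filter fun j => x j ≠ 0).card ≠ 0 ∧
      (cells.filter fun j => x j ≠ 0).card ≠ 16 := fun x hx => by rcases nz_setO hx with h | h <;> rw [h] <;> decide
  have hAO : Disjoint setA18 setO := by
    rw [Finset.disjoint_left]; intro x hA hO'; exact (hO x hO').1 (nz_setA18 hA)
  have hOW : Disjoint setO setW := by
    rw [Finset.disjoint_left]; intro x hO' hW; exact (hO x hO').2.1 (nz_setW hW)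
  have hOD : Disjoint setO setD18 := by
    rw [Finset.disjoint_left]; intro x hO' hD; exact (hO x hO').2.2 (nz_setD18 hD)
  have h2 : Disjoint (setA18 ∪ setO) setW := by
    rw [disjoint_union_left]
    exact ⟨disjoint_of_nz (by norm_num) (fun x => nz_setA18) (fun x => nz_setW), hOW⟩
  have h3 : Disjoint (setA18 ∪ setO ∪ setW) setD18 := by
    rw [disjoint_union_left, disjoint_union_left]
    exact ⟨⟨disjoint_of_nz (by norm_num) (fun x => nz_setA18) (fun x => nz_setD18), hOD⟩,
      disjoint_of_nz (by norm_num) (fun x => nz_setW) (fun x => nz_setD18)⟩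
  rw [cl18Int, card_union_of_disjoint h3, card_union_of_disjoint h2, card_union_of_disjoint hAO, card_setA18,
    card_setO, card_setW, card_setD18]

end Summit.Ventures.PackingBounds.Config.CL17
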